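import Literature.NumberTheory.Transcendental.ZudilinOddZeta
import HarnessLib

/-!
# Zudilin's function `φ₀(x, y)` and a certified lower-bound checker for `φ(x) = min_y φ₀(x, y)`

Topic `Literature/NumberTheory/Transcendental`. In the proof of [Zudilin2004, Theorem 3] the
exponents `ν_p` of the arithmetic factor `Φₙ = ∏ p^{ν_p}` ([Zudilin2004, (8.8)–(8.9)],
`Zudilin2004.nu`, `Zudilin2004.nuMin`, `Zudilin2004.Phi` of `ZudilinOddZeta.lean`) are values of the
integer-valued, doubly `1`-periodic function ([Zudilin2004, p. 270], `r = 3`, `q = 13`, `η₀ = 91`,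
`η₁ = η₂ = η₃ = 27`, `η_j = 25 + j`)

  `φ₀(x, y) = 3 (⌊y⌋ + ⌊91x − y⌋ − ⌊y − 27x⌋ − ⌊64x − y⌋ − 2⌊27x⌋)
              + Σ_{j=4}^{13} (⌊(41 − 2j)x⌋ − ⌊y − (25 + j)x⌋ − ⌊(66 − j)x − y⌋)`,

namely `ν_{k,p} = φ₀(n/p, (k-1)/p)` (`Zudilin2004.nu_eq_phi0`), so that `ν_p ≥ φ(n/p)` with
`φ(x) = min_{0 ≤ y < 1} φ₀(x, y)` ([Zudilin2004, p. 270]). The asymptotics of `log Φₙ` then follow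
from the prime number theorem once the step function `φ` is known on `(0, 1)`.

This file provides the machinery to CERTIFY lower bounds `φ₀(x, y) ≥ c` for all `x` in an open
rational interval and all `y`: a cell lists finitely many lines `y = s x + t`; between two
consecutive lines every floor term of `φ₀` is bounded below using only the values at the two
`x`-endpoints (integer Euclidean divisions), and `Zudilin2004.PhiCert.Cell.check` verifies the
resulting bound strip by strip. `Zudilin2004.PhiCert.Cell.check_sound` is its soundness; the table
of `φ` itself ([Zudilin2004, p. 271]) is certified in `ZudilinPhiTable*.lean` by `decide +kernel`.
Everything here is PROVED (no named facts).

## References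

* [Zudilin2004] W. Zudilin, *Arithmetic of linear forms involving odd zeta values*, J. Théor.
  Nombres Bordeaux 16 (2004), 251–291, §8 (8.8)–(8.9), (8.13), p. 270–271.
-/

noncomputable section

open Finset

namespace Literature.NumberTheory.Transcendental

namespace Zudilin2004

/-! ### `φ₀` and `ν_{k,p}` -/

/-- Zudilin's `φ₀(x, y)` for the parameters of Theorem 3. [cite: Zudilin2004, §8 p. 270] -/
def phi0 (x y : ℚ) : ℤ :=
  3 * (⌊y⌋ + ⌊91 * x - y⌋ - ⌊y - 27 * x⌋ - ⌊64 * x - y⌋ - 2 * ⌊27 * x⌋) +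
    ∑ j ∈ Icc (4 : ℕ) 13, (⌊((41 : ℚ) - 2 * j) * x⌋ - ⌊y - (25 + j) * x⌋ - ⌊((66 : ℚ) - j) * x - y⌋)

/-- `ν_{k,p} = φ₀(n/p, (k-1)/p)`. [cite: Zudilin2004, §8 (8.9), (8.13)] -/
theorem nu_eq_phi0 (n k p : ℕ) : nu n k p = phi0 ((n : ℚ) / p) (((k : ℚ) - 1) / p) := by
  unfold nu phi0
  have e2 : ((91 * n + 2 : ℚ) - k - 1) / p = 91 * ((n : ℚ) / p) - ((k : ℚ) - 1) / p := by ring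
  have e3 : ((k : ℚ) - (27 * n + 1)) / p = ((k : ℚ) - 1) / p - 27 * ((n : ℚ) / p) := by ring
  have e4 : ((91 * n + 2 : ℚ) - (27 * n + 1) - k) / p = 64 * ((n : ℚ) / p) - ((k : ℚ) - 1) / p := by
    ring
  have e5 : ((27 * n : ℚ)) / p = 27 * ((n : ℚ) / p) := by ring
  have e6 : ∀ j : ℕ, (((41 : ℚ) - 2 * j) * n) / p = ((41 : ℚ) - 2 * j) * ((n : ℚ) / p) := fun j => by
    ring
  have e7 : ∀ j : ℕ, ((k : ℚ) - ((25 + j) * n + 1)) / p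
      = ((k : ℚ) - 1) / p - (25 + j) * ((n : ℚ) / p) := fun j => by ring
  have e8 : ∀ j : ℕ, ((91 * n + 2 : ℚ) - ((25 + j) * n + 1) - k) / p
      = ((66 : ℚ) - j) * ((n : ℚ) / p) - ((k : ℚ) - 1) / p := fun j => by ring
  rw [e2, e3, e4, e5]
  congr 1
  exact Finset.sum_congr rfl fun j _ => by rw [e6, e7, e8]

/-- `φ₀` is `1`-periodic in `x`. [cite: Zudilin2004, §8 p. 270] -/
theorem phi0_add_int (x y : ℚ) (m : ℤ) : phi0 (x + m) y = phi0 x y := by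
  unfold phi0
  have h1 : ⌊91 * (x + m) - y⌋ = ⌊91 * x - y⌋ + 91 * m := by
    rw [show (91 : ℚ) * (x + m) - y = (91 * x - y) + ((91 * m : ℤ) : ℚ) by push_cast; ring,
      Int.floor_add_intCast]
  have h2 : ⌊y - 27 * (x + m)⌋ = ⌊y - 27 * x⌋ - 27 * m := by
    rw [show y - (27 : ℚ) * (x + m) = (y - 27 * x) - ((27 * m : ℤ) : ℚ) by push_cast; ring,
      Int.floor_sub_intCast]
  have h3 : ⌊64 * (x + m) - y⌋ = ⌊64 * x - y⌋ + 64 * m := by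
    rw [show (64 : ℚ) * (x + m) - y = (64 * x - y) + ((64 * m : ℤ) : ℚ) by push_cast; ring,
      Int.floor_add_intCast]
  have h4 : ⌊27 * (x + m)⌋ = ⌊27 * x⌋ + 27 * m := by
    rw [show (27 : ℚ) * (x + m) = 27 * x + ((27 * m : ℤ) : ℚ) by push_cast; ring,
      Int.floor_add_intCast]
  have h5 : ∀ j : ℕ, ⌊((41 : ℚ) - 2 * j) * (x + m)⌋ = ⌊((41 : ℚ) - 2 * j) * x⌋ + (41 - 2 * j) * m :=
    fun j => by
    rw [show ((41 : ℚ) - 2 * j) * (x + m) = ((41 : ℚ) - 2 * j) * x + (((41 - 2 * j) * m : ℤ) : ℚ) by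
      push_cast; ring, Int.floor_add_intCast]
  have h6 : ∀ j : ℕ, ⌊y - (25 + j) * (x + m)⌋ = ⌊y - (25 + j) * x⌋ - (25 + j) * m := fun j => by
    rw [show y - (25 + j : ℚ) * (x + m) = (y - (25 + j) * x) - (((25 + j) * m : ℤ) : ℚ) by
      push_cast; ring, Int.floor_sub_intCast]
  have h7 : ∀ j : ℕ, ⌊((66 : ℚ) - j) * (x + m) - y⌋ = ⌊((66 : ℚ) - j) * x - y⌋ + (66 - j) * m :=
    fun j => by
    rw [show ((66 : ℚ) - j) * (x + m) - y = (((66 : ℚ) - j) * x - y) + (((66 - j) * m : ℤ) : ℚ) by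
      push_cast; ring, Int.floor_add_intCast]
  rw [h1, h2, h3, h4]
  simp_rw [h5, h6, h7]
  have : ∑ j ∈ Icc (4 : ℕ) 13, (⌊((41 : ℚ) - 2 * j) * x⌋ + (41 - 2 * j) * m - (⌊y - (25 + j) * x⌋
      - (25 + j) * m) - (⌊((66 : ℚ) - j) * x - y⌋ + (66 - j) * m))
      = ∑ j ∈ Icc (4 : ℕ) 13, (⌊((41 : ℚ) - 2 * j) * x⌋ - ⌊y - (25 + j) * x⌋
        - ⌊((66 : ℚ) - j) * x - y⌋) := Finset.sum_congr rfl fun j _ => by ring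
  rw [this]
  ring

/-- `φ₀` is `1`-periodic in `y`. [cite: Zudilin2004, §8 p. 270] -/
theorem phi0_add_int_right (x y : ℚ) (m : ℤ) : phi0 x (y + m) = phi0 x y := by
  unfold phi0
  have h0 : ⌊y + (m : ℚ)⌋ = ⌊y⌋ + m := Int.floor_add_intCast y m
  have h1 : ⌊91 * x - (y + m)⌋ = ⌊91 * x - y⌋ - m := by
    rw [show (91 : ℚ) * x - (y + m) = (91 * x - y) - (m : ℚ) by ring, Int.floor_sub_intCast]
  have h2 : ⌊y + m - 27 * x⌋ = ⌊y - 27 * x⌋ + m := by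
    rw [show y + (m : ℚ) - 27 * x = (y - 27 * x) + (m : ℚ) by ring, Int.floor_add_intCast]
  have h3 : ⌊64 * x - (y + m)⌋ = ⌊64 * x - y⌋ - m := by
    rw [show (64 : ℚ) * x - (y + m) = (64 * x - y) - (m : ℚ) by ring, Int.floor_sub_intCast]
  have h6 : ∀ j : ℕ, ⌊y + m - (25 + j) * x⌋ = ⌊y - (25 + j) * x⌋ + m := fun j => by
    rw [show y + (m : ℚ) - (25 + j) * x = (y - (25 + j) * x) + (m : ℚ) by ring, Int.floor_add_intCast]
  have h7 : ∀ j : ℕ, ⌊((66 : ℚ) - j) * x - (y + m)⌋ = ⌊((66 : ℚ) - j) * x - y⌋ - m := fun j => by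
    rw [show ((66 : ℚ) - j) * x - (y + m) = (((66 : ℚ) - j) * x - y) - (m : ℚ) by ring,
      Int.floor_sub_intCast]
  rw [h0, h1, h2, h3]
  simp_rw [h6, h7]
  have : ∑ j ∈ Icc (4 : ℕ) 13, (⌊((41 : ℚ) - 2 * j) * x⌋ - (⌊y - (25 + j) * x⌋ + m)
      - (⌊((66 : ℚ) - j) * x - y⌋ - m))
      = ∑ j ∈ Icc (4 : ℕ) 13, (⌊((41 : ℚ) - 2 * j) * x⌋ - ⌊y - (25 + j) * x⌋
        - ⌊((66 : ℚ) - j) * x - y⌋) := Finset.sum_congr rfl fun j _ => by ring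
  rw [this]
  ring

/-- Reduction to the fundamental domain: `φ₀(x, y) = φ₀(fract x, fract y)`. [cite: Zudilin2004, §8 p. 270] -/
theorem phi0_eq_fract (x y : ℚ) : phi0 x y = phi0 (Int.fract x) (Int.fract y) := by
  conv_lhs => rw [← Int.fract_add_floor x, ← Int.fract_add_floor y]
  rw [phi0_add_int, phi0_add_int_right]

/-! ### `φ₀` as a list of floor terms -/

namespace PhiCert

/-- A line `y = s·x + t` with integer slope and offset. [cite: Zudilin2004, §8 p. 270] -/
structure Line where
  /-- slope -/
  s : ℤ
  /-- offset -/
  t : ℤ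
  deriving DecidableEq

/-- The ordinate `s x + t` of the line at `x`. [cite: Zudilin2004, §8 p. 270] -/
def Line.eval (L : Line) (x : ℚ) : ℚ := L.s * x + L.t

/-- The numerator of `L(a/b) - m·(a/b)` over the denominator `b`. [cite: Zudilin2004, §8 p. 270] -/
def Line.num (L : Line) (m a : ℤ) (b : ℕ) : ℤ := (L.s - m) * a + L.t * b

/-- The three kinds of floor terms of `φ₀`: `⌊y - a x⌋`, `⌊a x - y⌋`, `⌊a x⌋`. [cite: Zudilin2004, §8 p. 270] -/
inductive Kind
  /-- `⌊y - a x⌋` -/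
  | yax
  /-- `⌊a x - y⌋` -/
  | axy
  /-- `⌊a x⌋` -/
  | ax
  deriving DecidableEq

/-- A floor term `coef · ⌊±(y - a x)⌋` or `coef · ⌊a x⌋` of `φ₀`. [cite: Zudilin2004, §8 p. 270] -/
structure Term where
  /-- coefficient -/
  coef : ℤ
  /-- kind -/
  kind : Kind
  /-- the slope `a` -/
  a : ℤ

/-- The value of a floor term at `(x, y)`. [cite: Zudilin2004, §8 p. 270] -/
def Term.eval (T : Term) (x y : ℚ) : ℤ :=
  T.coef * (match T.kind with
    | .yax => ⌊y - T.a * x⌋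
    | .axy => ⌊T.a * x - y⌋
    | .ax => ⌊T.a * x⌋)

/-- The 35 floor terms of `φ₀` (`j = 4, …, 13` unrolled). [cite: Zudilin2004, §8 p. 270] -/
def terms : List Term :=
  [⟨3, .yax, 0⟩, ⟨3, .axy, 91⟩, ⟨-3, .yax, 27⟩, ⟨-3, .axy, 64⟩, ⟨-6, .ax, 27⟩,
   ⟨1, .ax, 33⟩, ⟨-1, .yax, 29⟩, ⟨-1, .axy, 62⟩,
   ⟨1, .ax, 31⟩, ⟨-1, .yax, 30⟩, ⟨-1, .axy, 61⟩,
   ⟨1, .ax, 29⟩, ⟨-1, .yax, 31⟩, ⟨-1, .axy, 60⟩,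
   ⟨1, .ax, 27⟩, ⟨-1, .yax, 32⟩, ⟨-1, .axy, 59⟩,
   ⟨1, .ax, 25⟩, ⟨-1, .yax, 33⟩, ⟨-1, .axy, 58⟩,
   ⟨1, .ax, 23⟩, ⟨-1, .yax, 34⟩, ⟨-1, .axy, 57⟩,
   ⟨1, .ax, 21⟩, ⟨-1, .yax, 35⟩, ⟨-1, .axy, 56⟩,
   ⟨1, .ax, 19⟩, ⟨-1, .yax, 36⟩, ⟨-1, .axy, 55⟩,
   ⟨1, .ax, 17⟩, ⟨-1, .yax, 37⟩, ⟨-1, .axy, 54⟩,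
   ⟨1, .ax, 15⟩, ⟨-1, .yax, 38⟩, ⟨-1, .axy, 53⟩]

/-- `φ₀(x, y)` is the sum of the 35 floor terms. [cite: Zudilin2004, §8 p. 270] -/
theorem phi0_eq_terms (x y : ℚ) : phi0 x y = (terms.map fun T => T.eval x y).sum := by
  rw [phi0, show Icc (4 : ℕ) 13 = {4, 5, 6, 7, 8, 9, 10, 11, 12, 13} by rfl]
  rw [sum_insert (by decide), sum_insert (by decide), sum_insert (by decide), sum_insert (by decide),
    sum_insert (by decide), sum_insert (by decide), sum_insert (by decide), sum_insert (by decide),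
    sum_insert (by decide), sum_singleton]
  simp only [terms, List.map_cons, List.map_nil, List.sum_cons, List.sum_nil, Term.eval]
  push_cast
  ring_nf

/-! ### The strip checker -/

/-- `⌊N / b⌋` for integers. [folklore] -/
def fl (N : ℤ) (b : ℕ) : ℤ := N / (b : ℤ)

/-- The largest integer `< N / b` (for `b > 0`). [folklore] -/
def flm1 (N : ℤ) (b : ℕ) : ℤ := (N - 1) / (b : ℤ)

/-- A lower bound for a floor term on the region `a₀/b₀ < x < a₁/b₁`, `lo(x) ≤ y < hi(x)`, computed
from the values at the two `x`-endpoints only. [cite: Zudilin2004, §8 p. 270] -/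
def Term.lb (T : Term) (a0 : ℤ) (b0 : ℕ) (a1 : ℤ) (b1 : ℕ) (lo hi : Line) : ℤ :=
  match T.kind with
  | .yax =>
      if 0 ≤ T.coef then T.coef * min (fl (lo.num T.a a0 b0) b0) (fl (lo.num T.a a1 b1) b1)
      else T.coef * max (flm1 (hi.num T.a a0 b0) b0) (flm1 (hi.num T.a a1 b1) b1)
  | .axy =>
      if 0 ≤ T.coef then T.coef * min (fl (-hi.num T.a a0 b0) b0) (fl (-hi.num T.a a1 b1) b1)
      else if lo.s = T.a then T.coef * fl (-lo.num T.a a0 b0) b0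
      else T.coef * max (flm1 (-lo.num T.a a0 b0) b0) (flm1 (-lo.num T.a a1 b1) b1)
  | .ax => if 0 ≤ T.coef then T.coef * fl (T.a * a0) b0 else T.coef * flm1 (T.a * a1) b1

/-- The certified lower bound for `φ₀` on a strip. [cite: Zudilin2004, §8 p. 270] -/
def stripLB (a0 : ℤ) (b0 : ℕ) (a1 : ℤ) (b1 : ℕ) (lo hi : Line) : ℤ :=
  (terms.map fun T => T.lb a0 b0 a1 b1 lo hi).sum

/-- A cell of the certificate: the open interval `(a₀/b₀, a₁/b₁)`, the claimed bound `c`, and the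
dividing lines between `y = 0` and `y = 1`. [cite: Zudilin2004, §8 p. 271] -/
structure Cell where
  /-- numerator of the left endpoint -/
  a0 : ℤ
  /-- denominator of the left endpoint -/
  b0 : ℕ
  /-- numerator of the right endpoint -/
  a1 : ℤ
  /-- denominator of the right endpoint -/
  b1 : ℕ
  /-- the claimed lower bound of `φ₀` on the cell -/
  c : ℤ
  /-- the dividing lines, bottom to top -/
  lines : List Line
  deriving DecidableEq

/-- Check the strips from the line `lo` upwards. [cite: Zudilin2004, §8 p. 271] -/
def Cell.go (C : Cell) : Line → List Line → Bool
  | l₁, [] => decide (C.c ≤ stripLB C.a0 C.b0 C.a1 C.b1 l₁ ⟨0, 1⟩)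
  | l₁, l₂ :: rest => decide (C.c ≤ stripLB C.a0 C.b0 C.a1 C.b1 l₁ l₂) && C.go l₂ rest

/-- The cell checker. [cite: Zudilin2004, §8 p. 271] -/
def Cell.check (C : Cell) : Bool :=
  decide (0 < C.b0) && decide (0 < C.b1) && C.go ⟨0, 0⟩ C.lines

/-! ### Soundness -/

/-- `L(a/b) - m (a/b) = num / b`. [folklore] -/
theorem Line.eval_sub_mul (L : Line) (m a : ℤ) {b : ℕ} (hb : 0 < b) :
    L.eval ((a : ℚ) / b) - m * ((a : ℚ) / b) = (L.num m a b : ℚ) / b := by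
  have hb' : (b : ℚ) ≠ 0 := by positivity
  unfold Line.eval Line.num
  field_simp
  push_cast
  ring

/-- An affine function on an open interval lies between its endpoint values. [folklore] -/
theorem affine_mem {α β x0 x1 x : ℚ} (h0 : x0 < x) (h1 : x < x1) :
    min (α * x0 + β) (α * x1 + β) ≤ α * x + β ∧ α * x + β ≤ max (α * x0 + β) (α * x1 + β) := by
  rcases le_total 0 α with hα | hα
  · have h0' : α * x0 ≤ α * x := mul_le_mul_of_nonneg_left h0.le hα
    have h1' : α * x ≤ α * x1 := mul_le_mul_of_nonneg_left h1.le hα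
    exact ⟨(min_le_left _ _).trans (by linarith), le_trans (by linarith) (le_max_right _ _)⟩
  · have h0' : α * x ≤ α * x0 := mul_le_mul_of_nonpos_left h0.le hα
    have h1' : α * x1 ≤ α * x := mul_le_mul_of_nonpos_left h1.le hα
    exact ⟨(min_le_right _ _).trans (by linarith), le_trans (by linarith) (le_max_left _ _)⟩

/-- A non-constant affine function on an open interval is strictly below its maximal endpoint value. [folklore] -/
theorem affine_lt_max {α β x0 x1 x : ℚ} (hα : α ≠ 0) (h0 : x0 < x) (h1 : x < x1) :
    α * x + β < max (α * x0 + β) (α * x1 + β) := by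
  rcases lt_or_gt_of_ne hα with hα | hα
  · have : α * x < α * x0 := mul_lt_mul_of_neg_left h0 hα
    exact lt_of_lt_of_le (by linarith) (le_max_left _ _)
  · have : α * x < α * x1 := mul_lt_mul_of_pos_left h1 hα
    exact lt_of_lt_of_le (by linarith) (le_max_right _ _)

/-- `N/b ≤ q ⟹ fl N b ≤ ⌊q⌋`. [folklore] -/
theorem fl_le_floor {N : ℤ} {b : ℕ} {q : ℚ} (h : (N : ℚ) / b ≤ q) : fl N b ≤ ⌊q⌋ := by
  rw [fl, ← Rat.floor_intCast_div_natCast]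
  exact Int.floor_le_floor h

/-- `q ≤ N/b ⟹ ⌊q⌋ ≤ fl N b`. [folklore] -/
theorem floor_le_fl {N : ℤ} {b : ℕ} {q : ℚ} (h : q ≤ (N : ℚ) / b) : ⌊q⌋ ≤ fl N b := by
  rw [fl, ← Rat.floor_intCast_div_natCast]
  exact Int.floor_le_floor h

/-- `q < N/b ⟹ ⌊q⌋ ≤ flm1 N b` (`b > 0`). [folklore] -/
theorem floor_le_flm1 {N : ℤ} {b : ℕ} (hb : 0 < b) {q : ℚ} (h : q < (N : ℚ) / b) :
    ⌊q⌋ ≤ flm1 N b := by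
  rw [flm1]
  have hb' : (0 : ℚ) < b := by exact_mod_cast hb
  have h1 : ((⌊q⌋ : ℤ) : ℚ) < (N : ℚ) / b := (Int.floor_le q).trans_lt h
  have h2 : ((⌊q⌋ * b : ℤ) : ℚ) < N := by
    push_cast
    rwa [lt_div_iff₀ hb'] at h1
  have h3 : ⌊q⌋ * b < N := by exact_mod_cast h2
  exact Int.le_ediv_of_mul_le (by exact_mod_cast hb) (by linarith)

/-- Lower bound via the minimum of two fractions. [folklore] -/
theorem min_fl_le_floor {N0 N1 : ℤ} {b0 b1 : ℕ} {q : ℚ}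
    (h : min ((N0 : ℚ) / b0) ((N1 : ℚ) / b1) ≤ q) : min (fl N0 b0) (fl N1 b1) ≤ ⌊q⌋ := by
  rcases le_total ((N0 : ℚ) / b0) ((N1 : ℚ) / b1) with hle | hle
  · rw [min_eq_left hle] at h
    exact (min_le_left _ _).trans (fl_le_floor h)
  · rw [min_eq_right hle] at h
    exact (min_le_right _ _).trans (fl_le_floor h)

/-- Upper bound via the maximum of two fractions (strict). [folklore] -/
theorem floor_le_max_flm1 {N0 N1 : ℤ} {b0 b1 : ℕ} (hb0 : 0 < b0) (hb1 : 0 < b1) {q : ℚ}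
    (h : q < max ((N0 : ℚ) / b0) ((N1 : ℚ) / b1)) : ⌊q⌋ ≤ max (flm1 N0 b0) (flm1 N1 b1) := by
  rcases lt_max_iff.1 h with h' | h'
  · exact (floor_le_flm1 hb0 h').trans (le_max_left _ _)
  · exact (floor_le_flm1 hb1 h').trans (le_max_right _ _)

/-- Admissible terms: `⌊a x⌋`-terms have `a > 0`. [folklore] -/
def Term.ok (T : Term) : Prop := T.kind = .ax → 0 < T.a

/-- **Soundness of the term bound.** [cite: Zudilin2004, §8 p. 270] -/
theorem Term.lb_le (T : Term) (hT : T.ok) {a0 a1 : ℤ} {b0 b1 : ℕ} (hb0 : 0 < b0) (hb1 : 0 < b1)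
    {lo hi : Line} {x y : ℚ} (hx0 : (a0 : ℚ) / b0 < x) (hx1 : x < (a1 : ℚ) / b1)
    (hlo : lo.eval x ≤ y) (hhi : y < hi.eval x) :
    T.lb a0 b0 a1 b1 lo hi ≤ T.eval x y := by
  -- the affine functions `lo(x) - a x` and `hi(x) - a x` at the endpoints
  have Hlo := affine_mem (α := (lo.s : ℚ) - T.a) (β := lo.t) hx0 hx1
  have Hhi := affine_mem (α := (hi.s : ℚ) - T.a) (β := hi.t) hx0 hx1
  have elo0 := lo.eval_sub_mul T.a a0 hb0
  have elo1 := lo.eval_sub_mul T.a a1 hb1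
  have ehi0 := hi.eval_sub_mul T.a a0 hb0
  have ehi1 := hi.eval_sub_mul T.a a1 hb1
  simp only [Line.eval] at elo0 elo1 ehi0 ehi1 hlo hhi
  have klo : ∀ z : ℚ, ((lo.s : ℚ) - T.a) * z + lo.t = (lo.s * z + lo.t) - T.a * z := fun z => by ring
  have khi : ∀ z : ℚ, ((hi.s : ℚ) - T.a) * z + hi.t = (hi.s * z + hi.t) - T.a * z := fun z => by ring
  simp only [klo, khi, elo0, elo1, ehi0, ehi1] at Hlo Hhi
  unfold Term.lb Term.eval
  rcases T with ⟨coef, kind, a⟩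
  simp only at *
  cases kind with
  | yax =>
    simp only
    split_ifs with hc
    · refine mul_le_mul_of_nonneg_left (min_fl_le_floor (Hlo.1.trans (by linarith))) hc
    · refine mul_le_mul_of_nonpos_left (floor_le_max_flm1 hb0 hb1 (lt_of_lt_of_le (by linarith) Hhi.2)) (le_of_lt (not_le.1 hc))
  | axy =>
    simp only
    split_ifs with hc hs
    · refine mul_le_mul_of_nonneg_left (min_fl_le_floor ?_) hc
      have : min (-((hi.num a a0 b0 : ℚ) / b0)) (-((hi.num a a1 b1 : ℚ) / b1)) ≤ a * x - y := by
        rw [min_neg_neg]; linarith [Hhi.2]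
      simpa [neg_div] using this
    · refine mul_le_mul_of_nonpos_left (floor_le_fl ?_) (le_of_lt (not_le.1 hc))
      -- `lo` has slope `a`: `lo(x) - a x` is constant
      have hconst : (lo.s : ℚ) * x + lo.t - a * x = (lo.num a a0 b0 : ℚ) / b0 := by
        rw [← elo0, hs]; ring
      have : (a : ℚ) * x - y ≤ -((lo.num a a0 b0 : ℚ) / b0) := by linarith
      simpa [neg_div] using this
    · refine mul_le_mul_of_nonpos_left (floor_le_max_flm1 hb0 hb1 ?_) (le_of_lt (not_le.1 hc))
      have hne : (a : ℚ) - lo.s ≠ 0 := by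
        have : (a : ℚ) ≠ lo.s := by exact_mod_cast (Ne.symm hs)
        exact sub_ne_zero.2 this
      have hlt := affine_lt_max (β := -(lo.t : ℚ)) hne hx0 hx1
      have k0 : ((a : ℚ) - lo.s) * ((a0 : ℚ) / b0) + -(lo.t : ℚ) = -((lo.num a a0 b0 : ℚ) / b0) := by
        rw [← elo0]; ring
      have k1 : ((a : ℚ) - lo.s) * ((a1 : ℚ) / b1) + -(lo.t : ℚ) = -((lo.num a a1 b1 : ℚ) / b1) := by
        rw [← elo1]; ring
      rw [k0, k1] at hlt
      have : (a : ℚ) * x - y < max (-((lo.num a a0 b0 : ℚ) / b0)) (-((lo.num a a1 b1 : ℚ) / b1)) :=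
        lt_of_le_of_lt (by linarith) hlt
      simpa [neg_div] using this
  | ax =>
    have ha : (0 : ℚ) < a := by exact_mod_cast hT rfl
    simp only
    split_ifs with hc
    · refine mul_le_mul_of_nonneg_left (fl_le_floor ?_) hc
      have : (a : ℚ) * ((a0 : ℚ) / b0) ≤ a * x := mul_le_mul_of_nonneg_left hx0.le ha.le
      push_cast
      linarith [this, mul_div_assoc (a : ℚ) a0 b0]
    · refine mul_le_mul_of_nonpos_left (floor_le_flm1 hb1 ?_) (le_of_lt (not_le.1 hc))
      have : (a : ℚ) * x < a * ((a1 : ℚ) / b1) := mul_lt_mul_of_pos_left hx1 ha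
      push_cast
      linarith [this, mul_div_assoc (a : ℚ) a1 b1]

/-- All terms of `φ₀` are admissible. [folklore] -/
theorem terms_ok : ∀ T ∈ terms, T.ok := by
  simp only [terms, Term.ok, List.mem_cons, List.not_mem_nil, or_false]
  rintro T (rfl | rfl | rfl | rfl | rfl | rfl | rfl | rfl | rfl | rfl | rfl | rfl | rfl | rfl | rfl | rfl |
    rfl | rfl | rfl | rfl | rfl | rfl | rfl | rfl | rfl | rfl | rfl | rfl | rfl | rfl | rfl | rfl | rfl |
    rfl | rfl) <;> simp

/-- Pointwise comparison of mapped list sums. [folklore] -/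
theorem sum_map_le_sum_map {ι : Type*} (l : List ι) {f g : ι → ℤ} (h : ∀ a ∈ l, f a ≤ g a) :
    (l.map f).sum ≤ (l.map g).sum := by
  induction l with
  | nil => simp
  | cons a l ih =>
    simp only [List.map_cons, List.sum_cons]
    exact add_le_add (h a (by simp)) (ih fun b hb => h b (by simp [hb]))

/-- **Soundness of the strip bound.** [cite: Zudilin2004, §8 p. 270] -/
theorem stripLB_le {a0 a1 : ℤ} {b0 b1 : ℕ} (hb0 : 0 < b0) (hb1 : 0 < b1) {lo hi : Line} {x y : ℚ}
    (hx0 : (a0 : ℚ) / b0 < x) (hx1 : x < (a1 : ℚ) / b1) (hlo : lo.eval x ≤ y) (hhi : y < hi.eval x) :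
    stripLB a0 b0 a1 b1 lo hi ≤ phi0 x y := by
  rw [phi0_eq_terms, stripLB]
  exact sum_map_le_sum_map terms fun T hT => T.lb_le (terms_ok T hT) hb0 hb1 hx0 hx1 hlo hhi

/-- Soundness of the strip recursion. [cite: Zudilin2004, §8 p. 271] -/
theorem Cell.go_sound (C : Cell) (hb0 : 0 < C.b0) (hb1 : 0 < C.b1) {x y : ℚ}
    (hx0 : (C.a0 : ℚ) / C.b0 < x) (hx1 : x < (C.a1 : ℚ) / C.b1) (hy1 : y < 1) :
    ∀ (rest : List Line) (lo : Line), lo.eval x ≤ y → C.go lo rest = true → C.c ≤ phi0 x y := by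
  intro rest
  induction rest with
  | nil =>
    intro lo hlo h
    simp only [Cell.go, decide_eq_true_eq] at h
    exact h.trans (stripLB_le hb0 hb1 hx0 hx1 hlo (by simpa [Line.eval] using hy1))
  | cons hi rest ih =>
    intro lo hlo h
    simp only [Cell.go, Bool.and_eq_true, decide_eq_true_eq] at h
    by_cases hy : y < hi.eval x
    · exact h.1.trans (stripLB_le hb0 hb1 hx0 hx1 hlo hy)
    · exact ih hi (not_lt.1 hy) h.2

/-- **Soundness of the cell checker**: if `C.check = true` then `φ₀(x, y) ≥ c` for all
`a₀/b₀ < x < a₁/b₁` and `0 ≤ y < 1`. [cite: Zudilin2004, §8 p. 271] -/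
theorem Cell.check_sound (C : Cell) (h : C.check = true) {x y : ℚ} (hx0 : (C.a0 : ℚ) / C.b0 < x)
    (hx1 : x < (C.a1 : ℚ) / C.b1) (hy0 : 0 ≤ y) (hy1 : y < 1) : C.c ≤ phi0 x y := by
  simp only [Cell.check, Bool.and_eq_true, decide_eq_true_eq] at h
  exact C.go_sound h.1.1 h.1.2 hx0 hx1 hy1 C.lines ⟨0, 0⟩ (by simpa [Line.eval] using hy0) h.2

/-- The bound for all `y`, by periodicity. [cite: Zudilin2004, §8 p. 271] -/
theorem Cell.check_sound' (C : Cell) (h : C.check = true) {x : ℚ} (hx0 : (C.a0 : ℚ) / C.b0 < x)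
    (hx1 : x < (C.a1 : ℚ) / C.b1) (y : ℚ) : C.c ≤ phi0 x y := by
  rw [← Int.fract_add_floor y, phi0_add_int_right]
  exact C.check_sound h hx0 hx1 (Int.fract_nonneg y) (Int.fract_lt_one y)

end PhiCert

end Zudilin2004

end Literature.NumberTheory.Transcendental
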